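import Literature.AnabelianGeometry.EtaleTheta.ThetaCyclotomes
import Literature.AnabelianGeometry.EtaleTheta.EtaleThetaClass
import Literature.AnabelianGeometry.EtaleTheta.MonoThetaEnv
import Mathlib.GroupTheory.Index
import HarnessLib

/-!
# [EtTh] §2 over §1: the covering `X̲̲` of type `(1, (ℤ/lℤ)^Θ)` over the §1 theta setting
# (merge adapter `ThetaSetting`/`EtaleThetaData` → `ThetaEnvData`/`RigidData`, part 1)

Mochizuki, *The étale theta function …*, Publ. RIMS **45** (2009), §2, PRIMS PDF pp. 36–41 (printed
262–267) [cite: MochizukiEtTh2009, Def 2.5 p.39]. Layer L2 of the abc-iut cell, wave-2 unit W2-L2-04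
(plan/L2/ASSIGNMENTS.md §I), seat abc-iut-L2-t8. Continuation of `ThetaCyclotomes.lean` (part 0:
`l·Δ_Θ`, the hypotheses `Sec2Hyps` incl. "`K = K̈`", the identification `CyclotomeMod` of `μ_N`).

"Now, we return to the discussion of §1. In particular, we assume that `K` is a finite extension of
`ℚ_p`" (p. 39). The interfaces `ThetaEnvData N` (`MonoThetaEnv.lean`) and `RigidData N l`
(`ThetaRigidity.lean`) of seat abc-iut-L2-t2 carry "the notation of the above discussion" (pp. 45–47)
for a curve `X̲̲` of type `(1, (ℤ/lℤ)^Θ)` (Def. 2.5 (i)) as abstract data tagged TODO-merge(abc-iut-L2-t1).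
The files `ThetaCyclotomes.lean` → `DoubleUnderline.lean` → `ThetaEnvOfSetting.lean` →
`RigidOfSetting.lean` RESOLVE that tag: every field is DEFINED from the §1 root `ThetaSetting`
(`Setting.lean`) and the étale theta class `EtaleThetaData.etaDd` (`EtaleThetaClass.lean`) of seat
abc-iut-L2-t1, and every interface axiom is PROVED, relative to the inputs of part 0 and to

* `EtaleThetaData.DoubleUnderline E l` (THIS file) — THE CHOICE the text makes on pp. 36–41: the
  covering `X̲̲ → X` ("determined, in effect, by the choice of a splitting of `D_x → G_K`", p. 41)
  through its tempered fundamental group `Π^tp_X̲̲ ⊆ Π^tp_X`, with the printed properties of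
  Def. 2.5 (i) / Prop. 2.2 (ii) / p. 41 as fields (quoted with page). Constructing such a choice from
  a splitting of `D_x ↠ G_K` (Prop. 2.2) is abc-iut-L2-t2's `ThetaCovers` side and is not done here.

PROVED here: `Π^tp_Ÿ = Π^tp_{Y₂}` and `[Π^tp_Y : Π^tp_Ÿ] = 2` under `K = K̈` from the root axioms
(`relIndex_GtpYdd_GtpY`); the surjection `Π^tp_X̲̲ ↠ ℤ`, `h ↦ toZ(h)/l`, with kernel
`Π^tp_Y̲̲ = Π^tp_Y ∩ Π^tp_X̲̲` (`toLZ`; "`Gal(Y̲̲/X̲̲) (≅ l·ℤ)`", Def. 2.13 (i)); "`Π^tp_X̲̲/Π^tp_Ÿ̲̲ ≅ (l·ℤ) × μ₂`" in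
the form `[Π^tp_Y̲̲ : Π^tp_Ÿ̲̲] = 2` (`relIndex_GtpYdd_inf`, from "`Y̲̲ → Y` of degree `l`" and `l` odd).
HONEST FRAMING: [EtTh] is refereed; the input structure is data quoting print and is not asserted;
no side is taken on any disputed claim.
-/

noncomputable section

namespace Literature.AnabelianGeometry.EtaleTheta

open Literature.AnabelianGeometry.SemiGraphs

namespace ThetaSetting

variable {p : ℕ} [Fact p.Prime] (D : ThetaSetting p)

/-! ### `Π^tp_Ÿ = Π^tp_{Y₂}` and `[Π^tp_Y : Π^tp_Ÿ] = 2` under `K = K̈` -/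

variable {D} in
/-- Under `K = K̈`: `Π^tp_Ÿ = Π^tp_{Y₂}` ("`Ÿ := Ÿ₁ = Y₂`", p. 17, and `J̈₁ = K₂ = K̈ = K`).
[cite: MochizukiEtTh2009, §1 p.17] -/
theorem GtpYdd_eq_GtpYN_two (hS : D.Sec2Hyps) : D.GtpYdd = D.GtpYN 2 := by
  change D.GtpYN (2 * 1) ⊓ (D.GJddN 1).comap D.aug.toMonoidHom = _
  rw [D.GJddN_one, mul_one]
  have h2 : D.GKN 2 = D.GK := hS.GKdd_eq
  rw [h2, comap_aug_GK, inf_top_eq]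

variable {D} in
/-- **`[Π^tp_Y : Π^tp_Ÿ] = 2`** under `K = K̈` ("`Π^tp_X/Π^tp_Ÿ ≅ Z × μ₂`", p. 41; from
`Δ^tp_Y/Δ^tp_{Y₂} ≅ ℤ/2ℤ(1)`, p. 16) — PROVED from the root axioms.
[cite: MochizukiEtTh2009, Def 2.7 p.41] -/
theorem relIndex_GtpYdd_GtpY (hS : D.Sec2Hyps) : D.GtpYdd.relIndex D.GtpY = 2 := by
  haveI := D.GtpYN_normal 2
  rw [GtpYdd_eq_GtpYN_two hS]
  conv_lhs => rw [GtpY_eq_sup hS]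
  rw [Subgroup.relIndex_sup_left, ← Subgroup.inf_relIndex_right]
  have h12 : D.GtpYN 2 ⊓ D.GtpY = D.GtpYN 2 := inf_eq_left.2 (D.GtpYN_le 2)
  have : D.GtpYN 2 ⊓ (D.GtpY ⊓ D.DeltaTemp) = D.GtpYN 2 ⊓ D.DeltaTemp := by
    rw [← inf_assoc, h12]
  rw [this]
  exact_mod_cast D.relIndex_deltaYN 2

/-! ### The choice of `X̲̲` -/

variable {D}

/-- **The covering `X̲̲ → X` of type `(1, (ℤ/lℤ)^Θ)`** (Def. 2.3, Def. 2.5 (i)) through its tempered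
fundamental group `Π^tp_X̲̲ ⊆ Π^tp_X`, with the printed properties as fields: "the quotient `Π_X ↠ Q`
factors through the natural quotient `Π^tp_X ↠ Ẑ` determined by the quotient `Π^tp_X ↠ Z`" (Def. 2.5 (i),
p. 39); "`G_K ≅ Π_X̲̲/Δ_X̲̲`" (Prop. 2.2 (iii), p. 37); "new coverings `Ÿ̲̲ → Ÿ`; `Y̲̲ → Y` of degree `l`"
(p. 41); "the 'geometric portion' `Δ_X̲̲` of `Π_X̲̲` maps isomorphically onto `Δ̄^ell_X`" — so that the theta
quotient of `Δ_X̲̲` meets `Δ_Θ` in "`Ker(Δ^Θ_* ↠ Δ^ell_*) = l·Δ_Θ`" (Prop. 2.2 (ii), p. 37; Prop. 2.12 (i),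
p. 45); and "it is a tautology that, upon restriction to the covering `Ÿ̲̲ → Ÿ` [which was determined, in
effect, by the choice of a splitting of `D_x → G_K`], the class `η̈^Θ` determines a class
`η̲̈^Θ ∈ H¹(Π^tp_Ÿ̲̲, l·Δ_Θ)`" (p. 41). A CHOICE (data), not an assertion; Def. 2.5 (i)'s second condition
("compatible with the `{±1}`-structure of Theorem 1.10, (iii)") has no carrier in §1's typing (Thm. 1.10
(iii) is not typed: layer L4 vocabulary) and is not recorded. ERRATUM E1 ([IUTchI] Rmk. 3.1.6): `l` odd.
[cite: MochizukiEtTh2009, Def 2.5 (i) p.39] -/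
structure EtaleThetaData.DoubleUnderline (E : D.EtaleThetaData) (l : ℕ) : Type where
  /-- `l` is odd (Prop. 2.2; [IUTchI] Rmk. 3.1.6) -/
  l_odd : Odd l
  /-- `Π^tp_X̲̲ ⊆ Π^tp_X`, the tempered fundamental group of `X̲̲` (p. 38, p. 41) -/
  Huu : Subgroup D.PiTemp
  /-- `X̲̲ → X` is a finite étale covering: `Π^tp_X̲̲` is open -/
  isOpen_Huu : IsOpen (Huu : Set D.PiTemp)
  /-- `Ÿ̲̲` (hence `Y̲̲`, `X̲̲`) is a geometrically connected curve over `K = K̈`: the image of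
  `Π^tp_Ÿ̲̲ = Π^tp_Ÿ ∩ Π^tp_X̲̲` in `G_{ℚ_p}` is all of `G_K` ("`G_K ≅ Π_X̲̲/Δ_X̲̲`", Prop. 2.2 (iii), p. 37;
  `Ÿ̲̲ → Ÿ` is the composite with `C̲̲ → C` "of degree `l`" with `Δ_X̲̲ = Im(s_ι)` of index `l` in `Δ_X̲`,
  Prop. 2.2 (ii), p. 41) -/
  map_aug_Ydduu : (D.GtpYdd ⊓ Huu).map D.aug.toMonoidHom = D.GK
  /-- Def. 2.5 (i): `Π_X ↠ Q (≅ ℤ/lℤ)` "factors through the natural quotient `Π^tp_X ↠ Ẑ` determined by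
  `Π^tp_X ↠ Z`" (p. 39), and `Gal(Y̲̲/X̲̲) ≅ l·ℤ` (Def. 2.13 (i), p. 47): the image of `Π^tp_X̲̲` in `Z` is `l·Z` -/
  map_toZ_Huu : Huu.map D.toZ = Subgroup.zpowers (Multiplicative.ofAdd (l : ℤ))
  /-- "`Y̲̲^log → Y^log` [is a covering] of degree `l`" (p. 41): `[Π^tp_Y : Π^tp_Y ∩ Π^tp_X̲̲] = l` -/
  relIndex_Huu_GtpY : (Huu ⊓ D.GtpY).relIndex D.GtpY = l
  /-- "`Δ_X̲̲ = Im(s_ι)`" maps isomorphically onto `Δ̄^ell_X` (Prop. 2.2 (ii), p. 37), i.e. the theta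
  quotient of `Π^tp_X̲̲` meets `Δ_Θ` in "`Ker(Δ^Θ_* ↠ Δ^ell_*) = l·Δ_Θ`" (Prop. 2.12 (i), p. 45) -/
  map_toTheta_Huu : Huu.map D.toTheta ⊓ D.DeltaTheta = D.lDeltaTheta l
  /-- "upon restriction to the covering `Ÿ̲̲ → Ÿ` … the class `η̈^Θ` determines a class
  `η̲̈^Θ ∈ H¹(Π^tp_Ÿ̲̲, l·Δ_Θ)`" (p. 41): some `l·Δ_Θ`-valued continuous cocycle on `Π^tp_Ÿ̲̲ = Π^tp_Ÿ ∩ Π^tp_X̲̲`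
  represents `η̈^Θ|_{Π^tp_Ÿ̲̲}` -/
  eta_res : ∃ (f : ↥(D.GtpYdd ⊓ Huu) → D.DeltaTheta)
      (hf : f ∈ contCocycles D.toTheta D.DeltaTheta (D.GtpYdd ⊓ Huu)),
      (∀ g, (f g : D.GtpTheta) ∈ D.lDeltaTheta l) ∧
      ContH1.mk f hf = ContH1.res D.toTheta D.DeltaTheta inf_le_left E.etaDd

namespace EtaleThetaData.DoubleUnderline

variable {E : D.EtaleThetaData} {l : ℕ} (C : E.DoubleUnderline l)

/-- `l ≠ 0` (`l` odd). [cite: MochizukiEtTh2009, Prop 2.2 p.36] -/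
theorem l_ne_zero (C : E.DoubleUnderline l) : l ≠ 0 := fun h => by simpa [h] using C.l_odd

/-- "`G_K ≅ Π_X̲̲/Δ_X̲̲`" (Prop. 2.2 (iii), p. 37): the image of `Π^tp_X̲̲` in `G_{ℚ_p}` is `G_K` (from
`map_aug_Ydduu`). [cite: MochizukiEtTh2009, Prop 2.2 (iii) p.37] -/
theorem map_aug_Huu : C.Huu.map D.aug.toMonoidHom = D.GK := by
  refine le_antisymm ?_ ?_
  · rintro _ ⟨x, -, rfl⟩
    exact D.aug_mem_GK x
  · rw [← C.map_aug_Ydduu]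
    exact Subgroup.map_mono inf_le_right

/-! #### `Gal(Y̲̲/X̲̲) ≅ ℤ` -/

/-- The exponent of `h ∈ Π^tp_X̲̲` in `Gal(Y̲̲/X̲̲) ≅ l·ℤ ≅ ℤ`: the image in `Z = ℤ` divided by `l`.
[cite: MochizukiEtTh2009, Def 2.13 (i) p.47] -/
def zExp (h : C.Huu) : ℤ := Multiplicative.toAdd (D.toZ (h : D.PiTemp)) / (l : ℤ)

/-- `toZ(h) = l · zExp(h)` for `h ∈ Π^tp_X̲̲`. [cite: MochizukiEtTh2009, Def 2.13 (i) p.47] -/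
theorem toZ_eq (h : C.Huu) : Multiplicative.toAdd (D.toZ (h : D.PiTemp)) = (l : ℤ) * C.zExp h := by
  have hl : (l : ℤ) ≠ 0 := by exact_mod_cast C.l_ne_zero
  obtain ⟨k, hk⟩ : ∃ k : ℤ, Multiplicative.toAdd (D.toZ (h : D.PiTemp)) = l * k := by
    have hmem : D.toZ (h : D.PiTemp) ∈ C.Huu.map D.toZ := ⟨h, h.2, rfl⟩
    rw [C.map_toZ_Huu, Subgroup.mem_zpowers_iff] at hmem
    obtain ⟨k, hk⟩ := hmem
    refine ⟨k, ?_⟩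
    rw [← hk]
    simp [mul_comm]
  rw [zExp, hk, Int.mul_ediv_cancel_left _ hl]

/-- `Π^tp_X̲̲ → ℤ`, `h ↦ toZ(h)/l`: the surjection `Π^tp_X̲̲ ↠ Gal(Y̲̲/X̲̲) ≅ l·ℤ ≅ ℤ`.
[cite: MochizukiEtTh2009, Def 2.13 (i) p.47] -/
def toLZ : C.Huu →* Multiplicative ℤ where
  toFun h := Multiplicative.ofAdd (C.zExp h)
  map_one' := by simp [zExp]
  map_mul' a b := by
    have hl : (l : ℤ) ≠ 0 := by exact_mod_cast C.l_ne_zero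
    rw [← ofAdd_add]
    congr 1
    apply mul_left_cancel₀ hl
    rw [mul_add, ← C.toZ_eq, ← C.toZ_eq, ← C.toZ_eq, Subgroup.coe_mul, map_mul, toAdd_mul]

/-- `Ker(Π^tp_X̲̲ → ℤ) = Π^tp_Y ∩ Π^tp_X̲̲ = Π^tp_Y̲̲`. [cite: MochizukiEtTh2009, Def 2.13 (i) p.47] -/
theorem toLZ_ker : C.toLZ.ker = D.GtpY.subgroupOf C.Huu := by
  have hl : (l : ℤ) ≠ 0 := by exact_mod_cast C.l_ne_zero
  ext h
  rw [MonoidHom.mem_ker, Subgroup.mem_subgroupOf]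
  change Multiplicative.ofAdd (C.zExp h) = 1 ↔ (h : D.PiTemp) ∈ D.toZ.ker
  rw [MonoidHom.mem_ker, ← ofAdd_zero, Multiplicative.ofAdd.injective.eq_iff]
  constructor
  · intro h0
    have := C.toZ_eq h
    rw [h0, mul_zero] at this
    exact Multiplicative.toAdd.injective (by simpa using this)
  · intro h1
    have h2 : (l : ℤ) * C.zExp h = 0 := by rw [← C.toZ_eq, h1]; rfl
    rcases mul_eq_zero.1 h2 with h | h
    · exact (hl h).elim
    · exact h

/-- `Π^tp_X̲̲ → ℤ` is onto (`l ∈ toZ(Π^tp_X̲̲)`). [cite: MochizukiEtTh2009, Def 2.13 (i) p.47] -/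
theorem toLZ_surjective : Function.Surjective C.toLZ := by
  have hl : (l : ℤ) ≠ 0 := by exact_mod_cast C.l_ne_zero
  have hmem : Multiplicative.ofAdd (l : ℤ) ∈ C.Huu.map D.toZ := by
    rw [C.map_toZ_Huu]; exact Subgroup.mem_zpowers _
  obtain ⟨h₀, h₀mem, h₀eq⟩ := hmem
  have h1 : C.toLZ ⟨h₀, h₀mem⟩ = Multiplicative.ofAdd 1 := by
    change Multiplicative.ofAdd (C.zExp _) = _
    congr 1
    apply mul_left_cancel₀ hl
    rw [← C.toZ_eq, mul_one]
    change Multiplicative.toAdd (D.toZ h₀) = _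
    rw [h₀eq]; rfl
  intro n
  refine ⟨⟨h₀, h₀mem⟩ ^ Multiplicative.toAdd n, ?_⟩
  rw [map_zpow, h1, ← ofAdd_zsmul, smul_eq_mul, mul_one]
  rfl

/-! #### `Π^tp_Ÿ̲̲ ⊆ Π^tp_Y̲̲ ⊆ Π^tp_X̲̲` -/

/-- `Π^tp_Ÿ̲̲ := Π^tp_Ÿ ∩ Π^tp_X̲̲` ("the composite of the coverings `Ÿ → C` … with `C̲̲ → C` determine[s]
… `Ÿ̲̲ → Ÿ`", p. 41), as a subgroup of `Π^tp_X`. [cite: MochizukiEtTh2009, Def 2.7 p.41] -/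
abbrev GtpYdduu : Subgroup D.PiTemp := D.GtpYdd ⊓ C.Huu

/-- **`[Π^tp_Y̲̲ : Π^tp_Ÿ̲̲] = 2`** ("`Π^tp_X̲̲/Π^tp_Ÿ̲̲ ≅ (l·Z) × μ₂`", p. 41) — PROVED from `[Π^tp_Y : Π^tp_Ÿ] = 2`,
"`Y̲̲ → Y` of degree `l`" and `l` odd. [cite: MochizukiEtTh2009, Def 2.7 p.41] -/
theorem relIndex_GtpYdd_inf (hS : D.Sec2Hyps) :
    D.GtpYdd.relIndex (C.Huu ⊓ D.GtpY) = 2 := by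
  have h2 : D.GtpYdd.relIndex D.GtpY = 2 := relIndex_GtpYdd_GtpY hS
  have hle : D.GtpYdd ≤ D.GtpY := D.GtpYdd_le_GtpY
  have hl : C.Huu.relIndex D.GtpY = l := by
    rw [← Subgroup.inf_relIndex_right]; exact C.relIndex_Huu_GtpY
  -- x * l = (W.relIndex B) * 2 with W.relIndex B ≤ l, l odd ⇒ x = 2
  have key := Subgroup.relIndex_inf_mul_relIndex D.GtpYdd C.Huu D.GtpY
  rw [hl, ← Subgroup.relIndex_mul_relIndex (D.GtpYdd ⊓ C.Huu) D.GtpYdd D.GtpY inf_le_left hle,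
    Subgroup.inf_relIndex_left, h2] at key
  have hl0 : l ≠ 0 := C.l_ne_zero
  have hWA : C.Huu.relIndex D.GtpY ≠ 0 := by rw [hl]; exact hl0
  have hWB_le : C.Huu.relIndex D.GtpYdd ≤ l :=
    (Subgroup.relIndex_le_of_le_right hle hWA).trans hl.le
  have hWB_ne : C.Huu.relIndex D.GtpYdd ≠ 0 := fun h0 =>
    hWA (Subgroup.relIndex_eq_zero_of_le_right hle h0)
  set x := D.GtpYdd.relIndex (C.Huu ⊓ D.GtpY) with hx
  set y := C.Huu.relIndex D.GtpYdd with hy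
  -- key : x * l = y * 2
  obtain ⟨m, hm⟩ := C.l_odd
  have hxl : x * l ≤ 2 * l := by rw [key]; omega
  have hx_le : x ≤ 2 := Nat.le_of_mul_le_mul_right hxl (Nat.pos_of_ne_zero hl0)
  interval_cases x
  · omega
  · omega
  · rfl

end EtaleThetaData.DoubleUnderline

end ThetaSetting

end Literature.AnabelianGeometry.EtaleTheta

end
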